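import Mathlib
import Summits.Ventures.PercRepro2.BoxUnionFKG

/-!
# Every union event is a sublattice of the status grid, so (UNION-PA) holds at every log-supermodular law
(blind cell PercRepro2, mine-1 g46; MINE1-UNIONROW-K3.md §14.6.)

Cells are status assignments `c : ι → Fin 3` (`T = 0 < N = 1 < S = 2`) on a finite set `ι` of observed vertices, with the
product (pointwise) lattice structure.  For test sets `X Y : Finset ι` the CUT SET is
`D(X,Y) = {c | ∃ i ∈ X, c i = S ∧ ∃ j ∈ Y, c j = T}` (the cells in which `s` hits `X` and `t` hits `Y`) and the UNION EVENT
is its complement.  The complement is closed under `⊓` and `⊔` (`cut_compl_inf`, `cut_compl_sup`): a meet in `D` has both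
arguments equal to `S` at some `i ∈ X` and one of them equal to `T` at some `j ∈ Y`, which puts that argument in `D`; joins
symmetrically.  Hence, by the cell's FKG lemma on a sublattice predicate (`BoxUnion.fkg_on`, from Mathlib's four functions
theorem), every (UNION-PA) fact `M(S₁ ∩ S₂ ∩ U)·M(U) ≥ M(S₁ ∩ U)·M(S₂ ∩ U)` for up-closed `S₁, S₂` holds at every
log-supermodular weight (`unionPA_of_lsm`) — in particular at every product law and along the curves of §14.2 / §14.4.
-/

namespace Summit.Ventures.PercRepro2.UnionEventSublattice

open Finset

variable {ι : Type*}

/-- the cut set of the test sets `X` (hit by `s`: status `S = 2`) and `Y` (hit by `t`: status `T = 0`) -/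
def InCut (X Y : Finset ι) (c : ι → Fin 3) : Prop := (∃ i ∈ X, c i = 2) ∧ (∃ j ∈ Y, c j = 0)

/-- a meet of two cells outside the cut is outside the cut -/
theorem cut_compl_inf (X Y : Finset ι) (a b : ι → Fin 3) (ha : ¬ InCut X Y a) (hb : ¬ InCut X Y b) :
    ¬ InCut X Y (a ⊓ b) := by
  rintro ⟨⟨i, hi, hiS⟩, ⟨j, hj, hjT⟩⟩
  have hiab : a i ⊓ b i = 2 := hiS
  have hjab : a j ⊓ b j = 0 := hjT
  have haS : a i = 2 := le_antisymm (Fin.le_last _) (hiab ▸ inf_le_left)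
  have hbS : b i = 2 := le_antisymm (Fin.le_last _) (hiab ▸ inf_le_right)
  rcases le_total (a j) (b j) with h | h
  · have : a j = 0 := by rw [← hjab, inf_eq_left.mpr h]
    exact ha ⟨⟨i, hi, haS⟩, ⟨j, hj, this⟩⟩
  · have : b j = 0 := by rw [← hjab, inf_eq_right.mpr h]
    exact hb ⟨⟨i, hi, hbS⟩, ⟨j, hj, this⟩⟩

/-- a join of two cells outside the cut is outside the cut -/
theorem cut_compl_sup (X Y : Finset ι) (a b : ι → Fin 3) (ha : ¬ InCut X Y a) (hb : ¬ InCut X Y b) :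
    ¬ InCut X Y (a ⊔ b) := by
  rintro ⟨⟨i, hi, hiS⟩, ⟨j, hj, hjT⟩⟩
  have hiab : a i ⊔ b i = 2 := hiS
  have hjab : a j ⊔ b j = 0 := hjT
  have haT : a j = 0 := le_antisymm (hjab ▸ le_sup_left) (Fin.zero_le _)
  have hbT : b j = 0 := le_antisymm (hjab ▸ le_sup_right) (Fin.zero_le _)
  rcases le_total (a i) (b i) with h | h
  · have : b i = 2 := by rw [← hiab, sup_eq_right.mpr h]
    exact hb ⟨⟨i, hi, this⟩, ⟨j, hj, hbT⟩⟩
  · have : a i = 2 := by rw [← hiab, sup_eq_left.mpr h]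
    exact ha ⟨⟨i, hi, this⟩, ⟨j, hj, haT⟩⟩

/-- the union event `U = D(X,Y)ᶜ` is closed under meets and joins: a sublattice predicate -/
theorem union_sublattice (X Y : Finset ι) (a b : ι → Fin 3) (ha : ¬ InCut X Y a) (hb : ¬ InCut X Y b) :
    ¬ InCut X Y (a ⊓ b) ∧ ¬ InCut X Y (a ⊔ b) :=
  ⟨cut_compl_inf X Y a b ha hb, cut_compl_sup X Y a b ha hb⟩

variable [Fintype ι] [DecidableEq ι]

open scoped Classical in
/-- **(UNION-PA) at every log-supermodular weight**: for a nonnegative log-supermodular weight `ν` on the status grid,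
test sets `X Y`, and up-closed sets `S₁ S₂` (predicates stable under `x ≤ y`), with `U = D(X,Y)ᶜ`:
`M(S₁ ∩ U) · M(S₂ ∩ U) ≤ M(U) · M(S₁ ∩ S₂ ∩ U)`. -/
theorem unionPA_of_lsm (ν : (ι → Fin 3) → ℝ) (hν : ∀ x, 0 ≤ ν x)
    (hlsm : ∀ x y, ν x * ν y ≤ ν (x ⊓ y) * ν (x ⊔ y)) (X Y : Finset ι)
    (S₁ S₂ : (ι → Fin 3) → Prop) (h₁ : ∀ x y, x ≤ y → S₁ x → S₁ y) (h₂ : ∀ x y, x ≤ y → S₂ x → S₂ y) :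
    (∑ x, if ¬ InCut X Y x ∧ S₁ x then ν x else 0) * (∑ x, if ¬ InCut X Y x ∧ S₂ x then ν x else 0)
      ≤ (∑ x, if ¬ InCut X Y x then ν x else 0) * (∑ x, if ¬ InCut X Y x ∧ S₁ x ∧ S₂ x then ν x else 0) := by
  have key := BoxUnion.fkg_on (ν := ν) (φ := fun x => if S₁ x then (1 : ℝ) else 0)
    (ψ := fun x => if S₂ x then (1 : ℝ) else 0) hν hlsm
    (fun x => by split_ifs <;> norm_num)
    (fun x => by split_ifs <;> norm_num)
    (fun x y _ _ => by
      by_cases hx : S₁ x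
      · rw [if_pos hx, if_pos (h₁ x (x ⊔ y) le_sup_left hx)]
      · rw [if_neg hx]; split_ifs <;> norm_num)
    (fun x y _ _ => by
      by_cases hx : S₂ x
      · rw [if_pos hx, if_pos (h₂ x (x ⊔ y) le_sup_left hx)]
      · rw [if_neg hx]; split_ifs <;> norm_num)
    (fun x => ¬ InCut X Y x) (fun x y hx hy => union_sublattice X Y x y hx hy)
  have e1 : (∑ x, if ¬ InCut X Y x then ν x * (if S₁ x then (1 : ℝ) else 0) else 0)
      = ∑ x, if ¬ InCut X Y x ∧ S₁ x then ν x else 0 := by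
    refine Finset.sum_congr rfl fun x _ => ?_
    by_cases hu : InCut X Y x <;> by_cases hs : S₁ x <;> simp [hu, hs]
  have e2 : (∑ x, if ¬ InCut X Y x then ν x * (if S₂ x then (1 : ℝ) else 0) else 0)
      = ∑ x, if ¬ InCut X Y x ∧ S₂ x then ν x else 0 := by
    refine Finset.sum_congr rfl fun x _ => ?_
    by_cases hu : InCut X Y x <;> by_cases hs : S₂ x <;> simp [hu, hs]
  have e3 : (∑ x, if ¬ InCut X Y x then ν x * ((if S₁ x then (1 : ℝ) else 0) * (if S₂ x then (1 : ℝ) else 0)) else 0)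
      = ∑ x, if ¬ InCut X Y x ∧ S₁ x ∧ S₂ x then ν x else 0 := by
    refine Finset.sum_congr rfl fun x _ => ?_
    by_cases hu : InCut X Y x <;> by_cases hs : S₁ x <;> by_cases ht : S₂ x <;> simp [hu, hs, ht]
  rw [e1, e2, e3] at key
  exact key

end Summit.Ventures.PercRepro2.UnionEventSublattice
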